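import Summits.ResolutionOfSingularities.ResolutionOfSingularities.Theorems.HilbertSamuelEliminationCampaignW42ToricMarkedLinkMoves

/-!
# [OURS · L1 W4.2] Toric marked monomial objects in dimension 3 — brick 5B (part 2a): THE POTENTIAL DROPS UNDER A CURVE MOVE

[OURS · L1 W4.2 · seat res-L1-s42-pv-2 gen 5] Memo `L/res-L1-s42-pv-2/CALIBRATION-W42-O2-v4.md` §3 (F6), (Q1) half: in the phase of residual order
`θs > 0`, when an ADMISSIBLE 2-face `{a, b}` is blown up, every `θs`-corner `C ⊇ {a, b}` is replaced by children among which the `θs`-corners `D`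
satisfy `Λ(D) < Λ(C)` (`Lam_lt_of_curve_move`): the replaced ray is not a maximal-contact ray (else the residual order drops, brick 3), so
`K(C) = {k}` with `k` the other ray of the face; either `K` grows in the child (first component of `Λ` drops) or the child reads its potential at the
same `k`, where the configuration of `𝒞_k` is translated (brick 5B part 1): `linkT` is unchanged and `psum2` drops by `θs·L > 0`.  The (Q2) half
(point move; bricks 4A + 5B part 1 `link_data_point_move`) and the Dershowitz–Manna descent are the remaining steps of `PhaseLemma`.  NOT a statement
of the manuscript under review nor of Blanco / Encinas–Villamayor.  AI work, weaker than expert review.  Pure proofs, no `sorry`, no new axiom.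
-/

set_option linter.dupNamespace false -- mandated namespace of this single-conjunct summit

namespace Summit.ResolutionOfSingularities.ResolutionOfSingularities.Theorems.CampaignW42.Toric

namespace TState

open Finset

variable {ι : Type} [Fintype ι] [Nonempty ι] [DecidableEq ι]

omit [DecidableEq ι] in
/-- In a positive phase, a corner with `K(C) ⊆ {k}` has `K(C) = {k}` and reads its potential at `k`. -/
theorem kmin_eq_of_Kset_subset_singleton {s : TState ι} {C : Finset ℕ} {k : ℕ} (hθ : 0 < s.thetaR C)
    (h : s.Kset C ⊆ {k}) : s.Kset C = {k} ∧ s.kmin C = k := by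
  have hne := Kset_nonempty hθ
  have heq : s.Kset C = {k} := by
    apply Finset.Subset.antisymm h
    intro r hr; rw [Finset.mem_singleton] at hr; subst hr
    obtain ⟨r', hr'⟩ := hne
    have := h hr'; rw [Finset.mem_singleton] at this; rw [← this]; exact hr'
  refine ⟨heq, ?_⟩
  unfold kmin; rw [dif_pos hne]
  have : (s.Kset C).min' hne ∈ ({k} : Finset ℕ) := heq ▸ Finset.min'_mem _ hne
  exact Finset.mem_singleton.mp this

/-- Lexicographic comparison helper for `Lam`: smaller first component. -/
private theorem lam_lt_of_fst {a a' : ℕ} {p p' : ℕ ×ₗ ℕ} (h : a' < a) : (toLex (a', p') : ℕ ×ₗ (ℕ ×ₗ ℕ)) < toLex (a, p) :=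
  Prod.Lex.lt_iff.mpr (Or.inl h)

/-- Lexicographic comparison helper for `Lam`: equal first and second components, smaller third. -/
private theorem lam_lt_of_thd {a t q q' : ℕ} (h : q' < q) :
    (toLex (a, toLex (t, q')) : ℕ ×ₗ (ℕ ×ₗ ℕ)) < toLex (a, toLex (t, q)) :=
  Prod.Lex.lt_iff.mpr (Or.inr ⟨rfl, Prod.Lex.lt_iff.mpr (Or.inr ⟨rfl, h⟩)⟩)

/-- **(Q1) THE POTENTIAL DROPS UNDER A CURVE MOVE.**  In the phase of residual order `θs > 0`, blow up an ADMISSIBLE 2-face `{a, b}`; let `C` be a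
`θs`-corner containing it and `D = (C ∖ x) ∪ {ρ}` (`x ∈ {a, b}`) a child that is again a `θs`-corner.  Then `Λ(D) < Λ(C)`. -/
theorem Lam_lt_of_curve_move {m : ℕ} {s : TState ι} (hs : s.Nonneg) (hwf : s.WF) {θs L : ℤ} (hθ : 0 < θs)
    (hL : CommonMult m θs L) {a b : ℕ} (hab : a ≠ b) (hadm : s.Admissible m θs {a, b}) {C : Finset ℕ} (hC : C ∈ s.cones)
    (habC : {a, b} ⊆ C) (hθC : s.thetaR C = θs) {x : ℕ} (hx : x ∈ ({a, b} : Finset ℕ))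
    (hθD : (s.move m {a, b}).thetaR (insert s.next (C.erase x)) = θs) :
    (s.move m {a, b}).Lam m θs L (insert s.next (C.erase x)) < s.Lam m θs L C := by
  have hnC : s.next ∉ C := hwf.next_notMem hC
  have hxC : x ∈ C := habC hx
  have hx' := hx
  simp only [Finset.mem_insert, Finset.mem_singleton] at hx'
  have hRθ : s.thetaR {a, b} = θs := hadm.2.1
  have hle : s.thetaR C ≤ s.thetaR {a, b} := by rw [hθC, hRθ]
  have hKsub : s.Kset C ⊆ {a, b} := hadm.Kset_subset habC hθC
  -- the replaced ray is not a maximal-contact ray (else the child would drop below θs)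
  have hxK : x ∉ s.Kset C := by
    intro hxK
    have := thetaR_child_lt_of_mem_Kset (m := m) habC hle hxK hnC
    rw [hθD, hθC] at this; exact lt_irrefl _ this
  -- the other ray `k` of the face is the unique maximal-contact ray
  obtain ⟨k, hkab, hkx⟩ : ∃ k ∈ ({a, b} : Finset ℕ), k ≠ x := by
    rcases hx' with rfl | rfl
    · exact ⟨b, by simp, hab.symm⟩
    · exact ⟨a, by simp, hab⟩
  have hkab' := hkab
  simp only [Finset.mem_insert, Finset.mem_singleton] at hkab'
  have hKk : s.Kset C ⊆ {k} := by
    intro r hr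
    have hrab := hKsub hr
    have hrx : r ≠ x := fun h => hxK (h ▸ hr)
    simp only [Finset.mem_insert, Finset.mem_singleton] at hrab ⊢
    omega
  have hθCpos : 0 < s.thetaR C := by rw [hθC]; exact hθ
  obtain ⟨hKC, hkminC⟩ := kmin_eq_of_Kset_subset_singleton hθCpos hKk
  have hkC : k ∈ C := habC hkab
  have habkx : ({a, b} : Finset ℕ) = {k, x} := by
    ext r; simp only [Finset.mem_insert, Finset.mem_singleton]; omega
  -- growth of K in the child
  have hθD' : (s.move m {a, b}).thetaR (insert s.next (C.erase x)) = s.thetaR C := by rw [hθD, hθC]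
  have hKD : s.Kset C ⊆ (s.move m {a, b}).Kset (insert s.next (C.erase x)) :=
    Kset_subset_Kset_child habC hle hxC hxK hnC hθD'
  rw [hKC] at hKD
  set D := insert s.next (C.erase x) with hDdef
  by_cases hcard : 2 ≤ ((s.move m {a, b}).Kset D).card
  · -- |K| grew: the first component drops
    unfold Lam; rw [hKC, Finset.card_singleton]
    exact lam_lt_of_fst (by omega)
  · -- K(D) = {k}: same reading ray; the configuration is translated
    have hcard1 : ((s.move m {a, b}).Kset D).card ≤ 1 := by omega
    have hKD1 : (s.move m {a, b}).Kset D = {k} :=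
      (Finset.eq_of_subset_of_card_le hKD (by rw [Finset.card_singleton]; exact hcard1)).symm
    have hθDpos : 0 < (s.move m {a, b}).thetaR D := by rw [hθD]; exact hθ
    obtain ⟨-, hkminD⟩ := kmin_eq_of_Kset_subset_singleton hθDpos hKD1.le
    -- the third ray of C
    have hcard3 : C.card = 3 := (hwf C hC).1
    have hxCk : x ∈ C.erase k := Finset.mem_erase.mpr ⟨hkx.symm, hxC⟩
    obtain ⟨j, hj⟩ : ∃ j, (C.erase k).erase x = {j} := Finset.card_eq_one.mp (by
      rw [Finset.card_erase_of_mem hxCk, Finset.card_erase_of_mem hkC, hcard3])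
    have hjmem : j ∈ (C.erase k).erase x := by rw [hj]; exact Finset.mem_singleton_self j
    have hjx : j ≠ x := (Finset.mem_erase.mp hjmem).1
    have hjk : j ≠ k := (Finset.mem_erase.mp (Finset.mem_erase.mp hjmem).2).1
    have hCe : C = {k, x, j} := by
      rw [← Finset.insert_erase hkC, ← Finset.insert_erase hxCk, hj]
    obtain ⟨hT, hP⟩ := link_data_curve_move (m := m) hs hwf hθ hL hkx hjk.symm hjx.symm hC hCe (by rw [← habkx]; exact hRθ)
    rw [← habkx] at hT hP
    -- compare
    unfold Lam
    rw [hKC, hKD1, Finset.card_singleton, hkminC, hkminD, hT, hP]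
    apply lam_lt_of_thd
    have hlegal : s.Legal m {a, b} := hadm.legal hs
    have hP0 : 0 ≤ s.psum2 m θs L k C - θs * L := by
      rw [← hP]; exact psum2_nonneg (hs.move hlegal) hθ hL k D
    have hLpos : 0 < θs * L := mul_pos hθ hL.1
    exact (Int.toNat_lt_toNat (by omega)).mpr (by omega)

end TState

end Summit.ResolutionOfSingularities.ResolutionOfSingularities.Theorems.CampaignW42.Toric
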